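/-
COR-CM (cell pub-hodgecm2, stage 2 of the Hodge ladder) — count-neutral KERNEL COMBINATORICS «the binary tetrahedral group SL(2,3)», part XV: the BLOCK
COUNT `β(SL(2,3), −1) = 176` (seat prover-pub-hodgecm2-b23-g53-0, binder prover b23, gen 53; claim HOME/INBOX.md l.24246, NAME ASK l.24300).  Theorems
only, on parts I, II, IIIa, XI and b09ʼs Burnside count `BlockParity.card_block_mul_card` BY NAME; `decide`/`norm_num` only on closed numerals, no
certificate, no named fact, no `sorry`.  `Interfaces.lean` (C1), every E term, B01, `Transposition/*`, `PortJoin/*`, `D2Bridge/*` untouched.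
HONEST FRAMING: `HC_CM` is NOT proved, here or anywhere in the tree; nothing here is a period, a count of record or a headline.
T5: n/a-class (hypothesis binders = the fields of `BinaryTetrahedral.Datum`); checker: self.
-/
import Summits.HodgeConjecture.CorCM.Census.BinaryTetrahedralWords
import Summits.HodgeConjecture.CorCM.Census.BinaryTetrahedralCounting
import Summits.HodgeConjecture.CorCM.Census.BlockParityBurnside

/-!
# The binary tetrahedral group, XV: `β(SL(2,3), −1) = 176`, `φ₂ = 174`

For a binary tetrahedral datum `D : Datum G c`: `c` is the only involution (§1, through `G/Q ≅ ℤ/3`); an element has `c` among its powers iff its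
order is even, and odd orders are `1` and `3` (§2); there are EXACTLY eight elements of order `3` (§3: at least eight by part IIIaʼs Sylow count — `⟨a⟩`
is not normal —, at most eight since the eight elements of order `6` and the eight of `Q` are disjoint from them); hence Burnsideʼs count reads
`β · 24 = 2¹² + 8 · 2⁴ = 4224`, **`β = 176`** and **`φ₂ = β − 2 = 174`** (§4) — the numerals of the last row of order `8p`.  All [folklore].

## References
* [Pohlmann1968] H. Pohlmann, Algebraic cycles on abelian varieties of complex multiplication type, Ann. of Math. 88 (1968), Thm 1.
* [Milne1999] J. S. Milne, Lefschetz motives and the Tate conjecture, Compositio Math. 117 (1999), Prop. 2.1, p. 54.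
-/

namespace Summit.HodgeConjecture.CorCM.Census.BinaryTetrahedral

open Finset
open Summit.HodgeConjecture.CorCM.Prior.AllgGroup.RfwfAllgGroup
open Summit.HodgeConjecture.CorCM.Census.BlockParity
open Summit.HodgeConjecture.CorCM.Census.Coinvariant

noncomputable section

variable {G : Type*} [Group G] [Fintype G] [DecidableEq G] {c : G} (D : Datum G c)

namespace Datum

include D

/-! ## §1 `c` is the only involution -/

omit [DecidableEq G] in
/-- The quaternion subgroup is normal (as an instance-free statement). [folklore] -/
theorem normal_Q : D.Q.Normal := ⟨fun _ hq y => D.conj_mem_Q y hq⟩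

omit [Fintype G] [DecidableEq G] in
/-- `|G / Q| = 3`. [folklore] -/
theorem card_quotient_Q : Nat.card (G ⧸ D.Q) = 3 := by
  have h := D.Q.card_eq_card_quotient_mul_card_subgroup
  rw [D.hcard, D.hQ] at h
  omega

omit [DecidableEq G] in
/-- **An element of order dividing `8` lies in `Q`** (its image in `G/Q ≅ ℤ/3` has order dividing `8` and `3`). [folklore] -/
theorem mem_Q_of_orderOf_dvd_eight {g : G} (hg : orderOf g ∣ 8) : g ∈ D.Q := by
  haveI := D.normal_Q
  have h8 : orderOf (QuotientGroup.mk' D.Q g) ∣ 8 := (orderOf_map_dvd _ g).trans hg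
  have h3 : orderOf (QuotientGroup.mk' D.Q g) ∣ 3 := D.card_quotient_Q ▸ orderOf_dvd_natCard _
  have h1 : orderOf (QuotientGroup.mk' D.Q g) = 1 :=
    Nat.dvd_one.mp (by have := Nat.dvd_gcd h8 h3; rwa [show Nat.gcd 8 3 = 1 by norm_num] at this)
  rw [orderOf_eq_one_iff] at h1
  exact (QuotientGroup.eq_one_iff g).mp h1

omit [DecidableEq G] in
/-- **`c` is the only involution**: `g² = 1 ⟹ g = 1 ∨ g = c`. [folklore] -/
theorem eq_one_or_eq_c_of_mul_self {g : G} (hg : g * g = 1) : g = 1 ∨ g = c := by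
  have hord : orderOf g ∣ 2 := orderOf_dvd_of_pow_eq_one (by rw [pow_two, hg])
  have hQ : g ∈ D.Q := D.mem_Q_of_orderOf_dvd_eight (hord.trans (by norm_num))
  obtain ⟨u, hu, v, hv, rfl⟩ := D.exists_word_of_mem_Q hQ
  have hi2 : D.i ^ 2 = c := by rw [pow_two, D.hii]
  have hi4 : D.i ^ 4 = 1 := D.i_pow_four
  -- `(iᵘ j)² = c ≠ 1`
  have hsqj : ∀ w : ℕ, (D.i ^ w * D.j) * (D.i ^ w * D.j) ≠ 1 := fun w h => by
    have e : (D.i ^ w * D.j) * (D.i ^ w * D.j) = c := by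
      have hc : D.j * D.i ^ w * D.j⁻¹ = (D.i ^ w)⁻¹ := by
        rw [← MulAut.conj_apply, map_pow, MulAut.conj_apply, D.hji, inv_pow]
      calc (D.i ^ w * D.j) * (D.i ^ w * D.j) = D.i ^ w * (D.j * D.i ^ w * D.j⁻¹) * (D.j * D.j) := by group
        _ = c := by rw [hc, D.hjj, mul_inv_cancel, one_mul]
    exact D.c_ne_one (e.symm.trans h)
  interval_cases v
  · rw [pow_zero, mul_one] at hg ⊢
    interval_cases u
    · exact Or.inl (pow_zero _)
    · rw [pow_one, D.hii] at hg; exact absurd hg D.c_ne_one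
    · exact Or.inr hi2
    · exfalso
      rw [← pow_add, show 3 + 3 = 4 + 2 by norm_num, pow_add, hi4, one_mul, hi2] at hg
      exact D.c_ne_one hg
  · rw [pow_one] at hg; exact absurd hg (hsqj u)

/-! ## §2 Orders -/

omit [DecidableEq G] in
/-- **`c ∈ ⟨g⟩` iff the order of `g` is even.** [folklore] -/
theorem c_mem_zpowers_iff_even (g : G) : c ∈ Subgroup.zpowers g ↔ Even (orderOf g) := by
  constructor
  · intro h
    have h2 : orderOf c ∣ orderOf g := orderOf_dvd_of_mem_zpowers h
    rw [D.orderOf_c] at h2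
    exact even_iff_two_dvd.mpr h2
  · rintro ⟨m, hm⟩
    have hm0 : m ≠ 0 := fun h0 => by
      rw [h0] at hm; exact (orderOf_pos g).ne' hm
    -- `g^m` is an involution, hence `c`
    have hsq : g ^ m * g ^ m = 1 := by rw [← pow_add, ← hm, pow_orderOf_eq_one]
    have hne : g ^ m ≠ 1 := fun h1 => by
      have := orderOf_dvd_of_pow_eq_one h1
      rw [hm] at this
      exact absurd (Nat.le_of_dvd (Nat.pos_of_ne_zero hm0) this) (by omega)
    rcases D.eq_one_or_eq_c_of_mul_self hsq with h | h
    · exact absurd h hne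
    · rw [← h]; exact Subgroup.pow_mem _ (Subgroup.mem_zpowers g) m

omit [DecidableEq G] in
/-- **Odd orders are `1` and `3`** (odd divisors of `24`). [folklore] -/
theorem orderOf_eq_one_or_three_of_odd {g : G} (hodd : Odd (orderOf g)) : orderOf g = 1 ∨ orderOf g = 3 := by
  have hdvd : orderOf g ∣ 24 := D.card_eq ▸ orderOf_dvd_card
  have h24 : (24 : ℕ) = 3 * 8 := by norm_num
  rw [h24] at hdvd
  have hcop : Nat.Coprime (orderOf g) 8 := by
    rw [show (8 : ℕ) = 2 ^ 3 by norm_num]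
    exact Nat.Coprime.pow_right _ (Nat.coprime_two_right.mpr hodd)
  have h3 : orderOf g ∣ 3 := hcop.dvd_of_dvd_mul_right hdvd
  rcases (Nat.dvd_prime Nat.prime_three).mp h3 with h | h
  · exact Or.inl h
  · exact Or.inr h

/-! ## §3 Exactly eight elements of order `3` -/

omit [DecidableEq G] in
/-- **`⟨a⟩` is not normal**: `j a j⁻¹ = c·a·(ij)` is the word `word 2 (1, 1)`, not a power `word 0 (0, n)` of `a`. [folklore] -/
theorem conj_a_notMem : ∃ w : G, w * D.a * w⁻¹ ∉ Subgroup.zpowers D.a := by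
  refine ⟨D.j, fun h => ?_⟩
  obtain ⟨n, hn3, hn⟩ := IndexTwoCyclic.exists_pow_eq_of_mem_zpowers h
  rw [D.hord_a] at hn3
  have hja : D.j * D.a = D.a * D.i := by
    calc D.j * D.a = (D.a * D.i * D.a⁻¹) * D.a := by rw [D.hai]
      _ = D.a * D.i := by group
  have e1 : D.j * D.a * D.j⁻¹ = word D 2 (1, 1) := by
    show D.j * D.a * D.j⁻¹ = cpow c 1 * D.a ^ (1 : ZMod 3).val * (D.i * D.j)
    rw [ZMod.val_one, pow_one, cpow, if_neg one_ne_zero, D.j_inv, hja]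
    calc D.a * D.i * (c * D.j) = (D.a * (D.i * c)) * D.j := by group
      _ = c * D.a * (D.i * D.j) := by rw [D.commute_i_c.eq, ← mul_assoc, D.commute_a_c.eq]; group
  have e2 : D.a ^ n = word D 0 (0, (n : ZMod 3)) := by
    show D.a ^ n = cpow c 0 * D.a ^ ((n : ZMod 3)).val * 1
    rw [cpow, if_pos rfl, one_mul, mul_one, ZMod.val_natCast_of_lt hn3]
  rw [e1, e2, word_eq_word_iff] at hn
  exact absurd hn.1 (by decide)

/-- **EXACTLY EIGHT ELEMENTS OF ORDER `3`.** [folklore] -/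
theorem card_orderOf_eq_three : (univ.filter (fun g : G => orderOf g = 3)).card = 8 := by
  classical
  have hG : Fintype.card G = 24 := D.card_eq
  have hX8 : 8 ≤ (univ.filter (fun g : G => orderOf g = 3)).card := eight_le_card_orderOf_eq_three hG D.hord_a D.conj_a_notMem
  have hY8 : 8 ≤ (univ.filter (fun g : G => orderOf g = 6)).card :=
    eight_le_card_orderOf_eq_six c hG D.hord_a D.conj_a_notMem D.c_mul_c D.c_ne_one D.hcen
  set X : Finset G := univ.filter (fun g : G => orderOf g = 3) with hX
  set Y : Finset G := univ.filter (fun g : G => orderOf g = 6) with hY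
  set QF : Finset G := univ.filter (fun g : G => g ∈ D.Q) with hQF
  have hQF8 : QF.card = 8 := by
    rw [hQF, ← Fintype.card_subtype, ← Nat.card_eq_fintype_card]; exact D.hQ
  have hdXY : Disjoint X Y := by
    rw [Finset.disjoint_filter]; intro x _ h1 h2; rw [h1] at h2; norm_num at h2
  have hdXQ : Disjoint X QF := by
    rw [Finset.disjoint_filter]; intro x _ h1 h2
    have h8 : orderOf x ∣ 8 := D.orderOf_dvd_eight_of_mem_Q h2
    rw [h1] at h8; norm_num at h8
  have hdYQ : Disjoint Y QF := by
    rw [Finset.disjoint_filter]; intro x _ h1 h2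
    have h8 : orderOf x ∣ 8 := D.orderOf_dvd_eight_of_mem_Q h2
    rw [h1] at h8; norm_num at h8
  have hsum : X.card + Y.card + QF.card ≤ 24 := by
    rw [← Finset.card_union_of_disjoint hdXY, ← Finset.card_union_of_disjoint (Finset.disjoint_union_left.mpr ⟨hdXQ, hdYQ⟩), ← hG]
    exact Finset.card_le_univ _
  omega

/-! ## §4 Burnside: `β = 176`, `φ₂ = 174` -/

/-- **The Burnside summand of the binary tetrahedral group**: `2¹²` at `1`, `2⁴` at the eight elements of order `3`, `0` elsewhere. [folklore] -/
theorem burnside_summand (g : G) :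
    (if c ∈ Subgroup.zpowers g then 0 else 2 ^ (Fintype.card G / orderOf g / 2)) =
      (if g = 1 then 4096 else if orderOf g = 3 then 16 else 0) := by
  rw [D.card_eq]
  by_cases hc : c ∈ Subgroup.zpowers g
  · have hev : Even (orderOf g) := (D.c_mem_zpowers_iff_even g).mp hc
    have hg1 : g ≠ 1 := fun h => by rw [h, orderOf_one] at hev; exact absurd hev (by decide)
    have hg3 : orderOf g ≠ 3 := fun h => by rw [h] at hev; exact absurd hev (by decide)
    rw [if_pos hc, if_neg hg1, if_neg hg3]
  · have hodd : Odd (orderOf g) := Nat.not_even_iff_odd.mp (fun h => hc ((D.c_mem_zpowers_iff_even g).mpr h))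
    rw [if_neg hc]
    rcases D.orderOf_eq_one_or_three_of_odd hodd with h | h
    · rw [orderOf_eq_one_iff.mp h, if_pos rfl, orderOf_one]; norm_num
    · have hg1 : g ≠ 1 := fun h1 => by rw [h1, orderOf_one] at h; exact absurd h (by decide)
      rw [if_neg hg1, if_pos h, h]; norm_num

/-- **`β(SL(2,3), −1) = 176`** by Burnside: `β · 24 = 2¹² + 8 · 2⁴`. [folklore] -/
theorem card_block_eq_oneHundredSeventySix : Fintype.card (Block c) = 176 := by
  classical
  have hB := card_block_mul_card c D.c_mul_c D.hcen
  simp only [D.burnside_summand] at hB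
  rw [Finset.sum_ite, Finset.sum_const, Finset.sum_ite, Finset.sum_const, Finset.sum_const_zero, add_zero, smul_eq_mul, smul_eq_mul] at hB
  have h1 : (univ.filter (fun g : G => g = 1)).card = 1 := by
    rw [Finset.filter_eq' univ (1 : G), if_pos (Finset.mem_univ _), Finset.card_singleton]
  have h3 : ((univ.filter (fun g : G => ¬ g = 1)).filter (fun g : G => orderOf g = 3)).card = 8 := by
    rw [Finset.filter_filter, ← D.card_orderOf_eq_three]
    congr 1
    refine Finset.filter_congr fun g _ => ⟨fun h => h.2, fun h => ⟨fun h1 => ?_, h⟩⟩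
    rw [h1, orderOf_one] at h; exact absurd h (by decide)
  rw [h1, h3, D.card_eq] at hB
  omega

/-- **`φ₂(SL(2,3), −1) = 174`.** [folklore] -/
theorem fibreTwo_eq_oneHundredSeventyFour : fibreTwo c D.c_mul_c = 174 := by
  have h := D.card_block_eq_fibreTwo_add_two
  rw [D.card_block_eq_oneHundredSeventySix] at h
  omega

end Datum

end

end Summit.HodgeConjecture.CorCM.Census.BinaryTetrahedral
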